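import Mathlib
import Literature.MathematicalPhysics.QuantumFieldTheory.PointwiseOSBoostKet
import Literature.Analysis.Complex.PeriodicLocalContinuation
import HarnessLib

/-!
# Local analytic continuation of `θ ↦ S(R_θ x)` by the pointwise OS boost calculus

The inductive step of the Osterwalder–Schrader route to rotation invariance of a Euclidean
correlation family `S` on `ℝ³` with a distinguished lattice frame (time axis `e₀`, rotation axis
`e₂`): IF the light cone of the transfer matrix in the plane `e₀e₁` and the two-sided one-spin
sandwich bound hold in the frame `e₀` (`PointwiseOSBoostCalculus.exists_boostCalculus`), and IF the
lower correlation functions are already invariant under the rotations `R_θ = planeRot 0 θ` about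
`e₂`, then around every angle `θ₀` at which the `n` points `R_{θ₀} x_i` have pairwise distinct
heights the orbit function `θ ↦ S_n(R_θ x)` is the restriction of a function holomorphic on a
vertical strip `|Re ζ - θ₀| < ε`, bounded by `K e^{2Δ |Im ζ|}` (`exists_local_boost_continuation`).

Mechanism (Glimm–Jaffe, *Quantum Physics* (1987), §19.5–19.7; Streater, CMP 26 (1972)): order the
points by height and split them as `A | a, b | B` with `|A| = ⌊(n-2)/2⌋`; the value `S_n(R_θ x)` is
the pairing `β(bra(θ), ket(θ))` of the chain vector of the mirror image of `A` (read at the angle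
`-θ`) with the chain vector of `a, b, B` (`PointwiseOSBoostVectors`, `PointwiseOSBoostKet`), all
measured from a virtual rotating reference point between `A` and `a`. At the complex angle
`θ + iχ` the chains stay in the light-cone tube with reserved times `u = e^{-R} h/16`
(`ChainItem.gap_mem_tube`), so the two spin insertions cost `u^{-Δ}` each while the block norms do
not depend on `χ`; this gives `F_R` on the rectangle `|Im ζ| < R` with `‖F_R‖ ≤ K₀ e^{2ΔR}`
(`exists_rect_boost_continuation`), and the rectangles are glued by
`exists_strip_continuation_of_rectangles`.

## References
* J. Glimm, A. Jaffe, *Quantum Physics* (2nd ed. 1987), §19.5–19.7.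
* R. F. Streater, CMP 26 (1972) 109–120.
* K. Osterwalder, R. Schrader, CMP 31 (1973); CMP 42 (1975).
-/

noncomputable section

open Filter ComplexConjugate Complex
open scoped InnerProductSpace Topology
open Literature.Probability.LatticeModels
open Literature.Analysis.OperatorTheory Literature.Analysis.OperatorTheory.KernelVectors
  Literature.Analysis.Complex

namespace Literature.MathematicalPhysics.QuantumFieldTheory

open ChainItem

local notation "E³" => EuclideanSpace ℝ (Fin 3)
local notation "e₀" => EuclideanSpace.single (0 : Fin 3) (1 : ℝ)
local notation "e₁" => EuclideanSpace.single (1 : Fin 3) (1 : ℝ)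
local notation "e₂" => EuclideanSpace.single (2 : Fin 3) (1 : ℝ)

variable {H : Type*} [NormedAddCommGroup H] [InnerProductSpace ℂ H] [CompleteSpace H]

/-! ## The local continuation -/

/-- **Continuation to a rectangle** `|Re ζ - θ₀| < ε, |Im ζ| < R` with the bound `K₀ e^{2ΔR}`,
`K₀` independent of `R`: the assembly `F_R = β(bra, ket)` of the chain vectors with reservation
`u = e^{-R} h'/2` (all the geometric inequalities are hypotheses here; `exists_local_boost_continuation`
derives them). [cite: GlimmJaffe1987, §19.5–19.7] -/
theorem exists_rect_boost_continuation (S : CorrFamily 3) {Δ C Cpd : ℝ} (hΔ : 0 ≤ Δ)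
    (δ : HalfSpaceConfig 3 0 → H) (hδ : DenseRange (Finsupp.linearCombination ℂ δ))
    (hK : ∀ a b, ⟪δ a, δ b⟫_ℂ = (osPointKernel S a b : ℂ)) (hT : IsTranslationInvariant S)
    (hP : IsPermutationSymmetric S)
    (hLC : ∀ (m : ℕ) (k : Fin m → ℕ) (A : (a : Fin m) → Fin (k a) → E³) (c : Fin m → ℝ)
      (m' : ℕ) (k' : Fin m' → ℕ) (B : (b : Fin m') → Fin (k' b) → E³) (d : Fin m' → ℝ),
      (∀ a i, 0 < A a i 0) → (∀ b j, 0 < B b j 0) →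
      ∃ G : ℂ × ℂ → ℂ, DifferentiableOn ℂ G {p : ℂ × ℂ | |p.2.im| < p.1.re} ∧
        (∀ t y : ℝ, 0 < t → G ((t : ℂ), (y : ℂ)) =
          ((∑ a, ∑ b, c a * d b * S (k a + k' b)
            (Fin.append (fun i => axisReflection 0 (A a i)) (fun j => B b j + t • e₀ + y • e₁)) : ℝ) : ℂ)) ∧
        (∀ p : ℂ × ℂ, |p.2.im| < p.1.re → ‖G p‖ ^ 2 ≤
          (∑ a, ∑ a', c a * c a' * S (k a + k a') (Fin.append (fun i => axisReflection 0 (A a i)) (A a'))) *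
          (∑ b, ∑ b', d b * d b' * S (k' b + k' b') (Fin.append (fun j => axisReflection 0 (B b j)) (B b')))))
    (hSB : ∀ u v : ℝ, 0 < u → 0 < v → ∀ y : E³, y 0 = 0 →
      ∀ (m : ℕ) (k : Fin m → ℕ) (A : (a : Fin m) → Fin (k a) → E³) (c : Fin m → ℝ)
        (m' : ℕ) (k' : Fin m' → ℕ) (B : (b : Fin m') → Fin (k' b) → E³) (d : Fin m' → ℝ),
        (∀ a i, 0 < A a i 0) → (∀ b j, 0 < B b j 0) →
        (∑ a, ∑ b, c a * d b * S (k a + 1 + k' b)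
            (Fin.append (Fin.append (fun i => axisReflection 0 (A a i + u • e₀)) ![y])
              (fun j => B b j + v • e₀))) ^ 2
          ≤ (C * (u ^ (-Δ) + v ^ (-Δ))) ^ 2 *
            (∑ a, ∑ a', c a * c a' * S (k a + k a') (Fin.append (fun i => axisReflection 0 (A a i)) (A a'))) *
            (∑ b, ∑ b', d b * d b' * S (k' b + k' b') (Fin.append (fun j => axisReflection 0 (B b j)) (B b'))))
    (hPD : ∀ (n : ℕ) (x : Fin n → E³) (r : ℝ), 0 < r → (∀ i j, i ≠ j → r ≤ ‖x i - x j‖) →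
      |S n x| ≤ Cpd ^ (n + 1) * (n.factorial : ℝ) * r ^ (-(n : ℝ) * Δ))
    {n a k : ℕ} (x : Fin n → E³) (hk : a + 3 + k = n)
    (hrotA : ∀ (φ : ℝ) (z : Fin (a + a) → E³), S (a + a) (fun i => planeRot (d := 2) 0 φ (z i)) = S (a + a) z)
    (hrotB : ∀ (φ : ℝ) (z : Fin (k + 1 + (k + 1)) → E³),
      S (k + 1 + (k + 1)) (fun i => planeRot (d := 2) 0 φ (z i)) = S (k + 1 + (k + 1)) z)
    (g : Fin (k + 3) → E³) (gA : Fin a → E³) (hgx : ∀ j, g j = x ⟨a + j, by omega⟩)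
    (hgAx : ∀ j, gA j = x ⟨a - 1 - j, by omega⟩) (qm qB : E³) (hqm2 : qm 2 = 0) (hqB2 : qB 2 = 0)
    {θ₀ ε h' : ℝ} (hh' : 0 < h')
    (hgq : ∀ θ : ℝ, |θ - θ₀| < ε → ∀ j, h' ≤ planeRot (d := 2) 0 θ (g j) 0 - planeRot (d := 2) 0 θ qm 0)
    (hgg : ∀ θ : ℝ, |θ - θ₀| < ε → ∀ i j : Fin (k + 3), i < j →
      h' ≤ planeRot (d := 2) 0 θ (g j) 0 - planeRot (d := 2) 0 θ (g i) 0)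
    (hgb : ∀ θ : ℝ, |θ - θ₀| < ε → h' ≤ planeRot (d := 2) 0 θ qB 0 - planeRot (d := 2) 0 θ (g ⟨1, by omega⟩) 0)
    (hg0B : ∀ θ : ℝ, |θ - θ₀| < ε → ∀ j : Fin (k + 1),
      h' ≤ planeRot (d := 2) 0 θ (g j.succ.succ) 0 - planeRot (d := 2) 0 θ qB 0)
    (hg0A : ∀ θ : ℝ, |θ - θ₀| < ε → ∀ j, h' ≤ planeRot (d := 2) 0 θ qm 0 - planeRot (d := 2) 0 θ (gA j) 0)
    (hgsA : ∀ θ : ℝ, |θ - θ₀| < ε → ∀ i j : Fin a, i < j →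
      h' ≤ planeRot (d := 2) 0 θ (gA i) 0 - planeRot (d := 2) 0 θ (gA j) 0)
    {R : ℝ} (hR : 0 < R) :
    ∃ F : ℂ → ℂ, DifferentiableOn ℂ F {z : ℂ | |z.re - θ₀| < ε ∧ |z.im| < R} ∧
      (∀ θ : ℝ, |θ - θ₀| < ε → F θ = ((S n (fun i => planeRot (d := 2) 0 θ (x i)) : ℝ) : ℂ)) ∧
      ∀ z : ℂ, |z.re - θ₀| < ε → |z.im| < R → ‖F z‖ ≤
        (Real.sqrt (Cpd ^ (a + a + 1) * ((a + a).factorial : ℝ) * h' ^ (-((a + a : ℕ) : ℝ) * Δ)) *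
          (512 * (1 + 8 * |C| * (h' / 2) ^ (-Δ)) ^ 2 *
            Real.sqrt (Cpd ^ (k + 1 + (k + 1) + 1) * ((k + 1 + (k + 1)).factorial : ℝ) *
              h' ^ (-((k + 1 + (k + 1) : ℕ) : ℝ) * Δ)))) * Real.exp (2 * Δ * R) := by
  have hreal : ∀ a b, (⟪δ a, δ b⟫_ℂ).im = 0 := im_inner_gen_eq_zero hK
  -- the reservation time
  obtain ⟨u, hu_def⟩ : ∃ u : ℝ, u = Real.exp (-R) * h' / 2 := ⟨_, rfl⟩
  have hu : 0 < u := by rw [hu_def]; positivity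
  have huR : 2 * u ≤ Real.exp (-R) * h' := by rw [hu_def]; linarith
  have hu2 : u < h' / 2 := by
    have : Real.exp (-R) < 1 := Real.exp_lt_one_iff.2 (by linarith)
    rw [hu_def]; nlinarith
  -- the calculus
  obtain ⟨N, B, hNb, hNd, hNσ, hNc, hBb, hBκ, hBreal⟩ := exists_boostCalculus S hu δ hδ hK hT hLC hSB
  obtain ⟨CB, hCBdef⟩ : ∃ CB : ℝ, CB = max 1 (8 * |C| * u ^ (-Δ)) := ⟨_, rfl⟩
  have hCB : 1 ≤ CB := by rw [hCBdef]; exact le_max_left _ _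
  have hBb' : ∀ w, ‖B w‖ ≤ CB := fun w => (hBb w).trans (by rw [hCBdef]; exact le_max_right _ _)
  have hN' : ∀ (U : Set ℂ), IsOpen U → ∀ (q : ℂ → ℂ × ℂ), DifferentiableOn ℂ q U →
      (∀ z ∈ U, |(q z).2.im| < (q z).1.re) → DifferentiableOn ℂ (fun z => N (q z)) U :=
    fun U hU q hq hqU => differentiableOn_coneFamily_comp δ hδ hNb hNd hU hq hqU
  have hNc' : ∀ p : ℂ × ℂ, |p.2.im| < p.1.re → ∀ φ : H,
      conjOp δ (N p φ) = N (conj p.1, conj p.2) (conjOp δ φ) :=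
    fun p hp φ => conjOp_coneFamily_apply δ hδ hreal hNc hp φ
  have hBc : ∀ (w : ℝ) (φ : H), conjOp δ (B w φ) = B w (conjOp δ φ) :=
    fun w φ => conjOp_clm_apply_of_real δ hδ hreal (hBreal w) φ
  -- the upper block
  obtain ⟨ysB, hysB⟩ : ∃ ysB : Fin (k + 1) → E³, ysB = fun j => g j.succ.succ := ⟨_, rfl⟩
  have hg0B' : ∀ θ : ℝ, |θ - θ₀| < ε → ∀ j, h' ≤ planeRot (d := 2) 0 θ (ysB j) 0 - planeRot (d := 2) 0 θ qB 0 := by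
    intro θ hθ j; rw [hysB]; exact hg0B θ hθ j
  have hgsB : ∀ θ : ℝ, |θ - θ₀| < ε → ∀ i j : Fin (k + 1), i < j →
      h' ≤ planeRot (d := 2) 0 θ (ysB j) 0 - planeRot (d := 2) 0 θ (ysB i) 0 := by
    intro θ hθ i j hij
    rw [hysB]
    exact hgg θ hθ i.succ.succ j.succ.succ (by simpa using hij)
  obtain ⟨Vb, hVb⟩ : ∃ Vb : ℂ → H, Vb = fun ζ => chainOp N B u (List.ofFn fun j => itemOf (ysB j)) (virtOf qB) ζ
    (δ (HalfSpaceConfig.empty 3 0)) := ⟨_, rfl⟩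
  obtain ⟨hVb1, hVb2, -, hVb4, -, hVb6⟩ := block_props S δ hδ hK hPD hu hCB hNb hN' hNσ hNc' hBb' hBκ hBc
    hrotB ysB hqB2 hh' hR huR hg0B' hgsB hVb
  -- the ket
  have hga : ∀ θ : ℝ, |θ - θ₀| < ε → h' ≤ planeRot (d := 2) 0 θ (g ⟨0, by omega⟩) 0 - planeRot (d := 2) 0 θ qm 0 :=
    fun θ hθ => hgq θ hθ _
  have hgab : ∀ θ : ℝ, |θ - θ₀| < ε →
      h' ≤ planeRot (d := 2) 0 θ (g ⟨1, by omega⟩) 0 - planeRot (d := 2) 0 θ (g ⟨0, by omega⟩) 0 :=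
    fun θ hθ => hgg θ hθ _ _ (Fin.mk_lt_mk.2 (by norm_num))
  obtain ⟨Wk, hWk⟩ : ∃ Wk : ℂ → H, Wk = fun ζ => chainOp N B u [itemOf (g ⟨0, by omega⟩), itemOf (g ⟨1, by omega⟩)]
    (virtOf qm) ζ (N (gap u (itemOf (g ⟨1, by omega⟩)) (virtOf qB) ζ) (Vb ζ)) := ⟨_, rfl⟩
  obtain ⟨hW1, -, hW3, hW4⟩ := ket_props δ hu hCB hNb hN' hNσ hNc' hBb' hBκ hBc (g ⟨0, by omega⟩) (g ⟨1, by omega⟩)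
    ysB qm qB hh' hR huR hga hgab hgb hVb1 hVb2 hVb6 hWk
  -- the bra
  obtain ⟨Wb, hWb⟩ : ∃ Wb : ℂ → H, Wb = fun ζ => chainOp N B u (List.ofFn fun j => (itemOf (gA j)).refl)
    (virtOf qm).refl (-ζ) (δ (HalfSpaceConfig.empty 3 0)) := ⟨_, rfl⟩
  obtain ⟨hA1, -, hA3, hA4⟩ := bra_props S δ hδ hK hPD hu hCB hNb hN' hNσ hNc' hBb' hBκ hBc
    hrotA gA hqm2 hh' hR huR hg0A hgsA hWb
  -- the pairing
  refine ⟨fun ζ => pairing δ hδ hreal (Wb ζ) (Wk ζ), hA1.kernelPairing δ hδ hreal hW1, fun θ hθ => ?_,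
    fun z hz hz' => ?_⟩
  · -- real values
    obtain ⟨hinjA, hposA, eA⟩ := hA3 θ hθ
    have hchK : List.IsChain (fun Q P => res u Q + res u P < P.t θ - Q.t θ)
        (virtOf qm :: List.ofFn fun j => itemOf (g j)) := by
      refine isChain_cons_ofFn (virtOf qm) (fun j => itemOf (g j)) (fun hm => ?_) (fun i hi => ?_)
      · rw [res_virtOf, res_itemOf, itemOf_t, virtOf_t]
        have := hga θ hθ; linarith
      · rw [res_itemOf, res_itemOf, itemOf_t, itemOf_t]
        have := hgg θ hθ ⟨i, by omega⟩ ⟨i + 1, hi⟩ (Fin.mk_lt_mk.2 (by omega)); linarith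
    obtain ⟨hinjK, hposK⟩ := block_cluster_inj_pos g qm θ hh' (hgq θ hθ) (hgg θ hθ)
    have hlist : (List.ofFn fun j => itemOf (g j)) =
        itemOf (g ⟨0, by omega⟩) :: itemOf (g ⟨1, by omega⟩) :: List.ofFn fun j => itemOf (ysB j) := by
      rw [List.ofFn_succ, List.ofFn_succ, hysB]
      rfl
    have eK := chainCfg_ofFn_eq hu θ g hqm2 hchK hinjK hposK
    rw [hlist] at eK
    show pairing δ hδ hreal (Wb θ) (Wk θ) = _
    rw [eA, hW3 θ hθ, eK, pairing_gen_left, hK]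
    norm_cast
    exact osPointKernel_bra_ket S hT hP x (by omega) gA g hgAx hgx θ qm ⟨hinjA, hposA, rfl⟩ ⟨hinjK, hposK, rfl⟩
  · -- the bound on the rectangle
    have hb : ‖Wb z‖ ≤ Real.sqrt (Cpd ^ (a + a + 1) * ((a + a).factorial : ℝ) * h' ^ (-((a + a : ℕ) : ℝ) * Δ)) := by
      calc ‖Wb z‖ = Real.sqrt (‖Wb z‖ ^ 2) := (Real.sqrt_sq (norm_nonneg _)).symm
        _ ≤ _ := Real.sqrt_le_sqrt (hA4 z hz hz')
    have hkb : ‖Vb z‖ ≤ Real.sqrt (Cpd ^ (k + 1 + (k + 1) + 1) * ((k + 1 + (k + 1)).factorial : ℝ) *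
        h' ^ (-((k + 1 + (k + 1) : ℕ) : ℝ) * Δ)) := by
      calc ‖Vb z‖ = Real.sqrt (‖Vb z‖ ^ 2) := (Real.sqrt_sq (norm_nonneg _)).symm
        _ ≤ _ := Real.sqrt_le_sqrt (hVb4 z hz hz')
    set K₁ : ℝ := 1 + 8 * |C| * (h' / 2) ^ (-Δ) with hK₁
    have hK₁1 : 1 ≤ K₁ := by
      rw [hK₁]; have : 0 ≤ 8 * |C| * (h' / 2) ^ (-Δ) := by positivity
      linarith
    have hCBle : CB ≤ K₁ * Real.exp (Δ * R) := by
      have hexp1 : 1 ≤ Real.exp (Δ * R) := Real.one_le_exp (by positivity)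
      rw [hCBdef]
      refine max_le ?_ ?_
      · nlinarith
      · have hu' : u ^ (-Δ) = (h' / 2) ^ (-Δ) * Real.exp (Δ * R) := by
          rw [hu_def, show Real.exp (-R) * h' / 2 = Real.exp (-R) * (h' / 2) by ring,
            Real.mul_rpow (Real.exp_pos _).le (by positivity), ← Real.exp_mul]
          ring_nf
        rw [hu']
        have h8 : 8 * |C| * ((h' / 2) ^ (-Δ) * Real.exp (Δ * R)) =
            (8 * |C| * (h' / 2) ^ (-Δ)) * Real.exp (Δ * R) := by ring
        rw [h8]
        gcongr
        rw [hK₁]; linarith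
    have hCB0 : 0 ≤ CB := le_trans zero_le_one hCB
    have hCB2 : (8 * CB) ^ 2 * 8 ≤ 512 * K₁ ^ 2 * Real.exp (2 * Δ * R) := by
      have h1 : CB ^ 2 ≤ (K₁ * Real.exp (Δ * R)) ^ 2 := pow_le_pow_left₀ hCB0 hCBle 2
      have h2 : (K₁ * Real.exp (Δ * R)) ^ 2 = K₁ ^ 2 * Real.exp (2 * Δ * R) := by
        rw [mul_pow, ← Real.exp_nat_mul]; push_cast; ring_nf
      rw [h2] at h1
      nlinarith
    calc ‖pairing δ hδ hreal (Wb z) (Wk z)‖ ≤ ‖Wb z‖ * ‖Wk z‖ := norm_pairing_le δ hδ hreal _ _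
      _ ≤ ‖Wb z‖ * ((8 * CB) ^ 2 * 8 * ‖Vb z‖) := by gcongr; exact hW4 z hz hz'
      _ ≤ Real.sqrt (Cpd ^ (a + a + 1) * ((a + a).factorial : ℝ) * h' ^ (-((a + a : ℕ) : ℝ) * Δ)) *
          ((512 * K₁ ^ 2 * Real.exp (2 * Δ * R)) *
            Real.sqrt (Cpd ^ (k + 1 + (k + 1) + 1) * ((k + 1 + (k + 1)).factorial : ℝ) *
              h' ^ (-((k + 1 + (k + 1) : ℕ) : ℝ) * Δ))) := by gcongr
      _ = _ := by rw [hK₁]; ring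

/-- **Local analytic continuation of the orbit function** (the inductive step). Let `S` be a
translation-invariant, permutation-symmetric correlation family on `ℝ³` whose OS kernel along `e₀`
is realised by kernel vectors `δ`, satisfying the frame-`e₀` light cone `hLC`, the two-sided sigma
bound `hSB` (exponent `Δ ≥ 0`) and Gaussian domination `hPD`, and suppose `S_m` is invariant under
the rotations about `e₂` for all `m < n`. If on the interval `|θ - θ₀| < ε ≤ 1` the heights of the
`n ≥ 3` rotated points `R_θ x_i` increase with `i` with gaps `≥ h > 0`, then `θ ↦ S_n(R_θ x)` is on
that interval the restriction of a function holomorphic on the strip `|Re ζ - θ₀| < ε` and bounded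
there by `K e^{2Δ |Im ζ|}`. [cite: GlimmJaffe1987, §19.5–19.7] -/
theorem exists_local_boost_continuation (S : CorrFamily 3) {Δ C Cpd : ℝ} (hΔ : 0 ≤ Δ)
    (δ : HalfSpaceConfig 3 0 → H) (hδ : DenseRange (Finsupp.linearCombination ℂ δ))
    (hK : ∀ a b, ⟪δ a, δ b⟫_ℂ = (osPointKernel S a b : ℂ)) (hT : IsTranslationInvariant S)
    (hP : IsPermutationSymmetric S)
    (hLC : ∀ (m : ℕ) (k : Fin m → ℕ) (A : (a : Fin m) → Fin (k a) → E³) (c : Fin m → ℝ)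
      (m' : ℕ) (k' : Fin m' → ℕ) (B : (b : Fin m') → Fin (k' b) → E³) (d : Fin m' → ℝ),
      (∀ a i, 0 < A a i 0) → (∀ b j, 0 < B b j 0) →
      ∃ G : ℂ × ℂ → ℂ, DifferentiableOn ℂ G {p : ℂ × ℂ | |p.2.im| < p.1.re} ∧
        (∀ t y : ℝ, 0 < t → G ((t : ℂ), (y : ℂ)) =
          ((∑ a, ∑ b, c a * d b * S (k a + k' b)
            (Fin.append (fun i => axisReflection 0 (A a i)) (fun j => B b j + t • e₀ + y • e₁)) : ℝ) : ℂ)) ∧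
        (∀ p : ℂ × ℂ, |p.2.im| < p.1.re → ‖G p‖ ^ 2 ≤
          (∑ a, ∑ a', c a * c a' * S (k a + k a') (Fin.append (fun i => axisReflection 0 (A a i)) (A a'))) *
          (∑ b, ∑ b', d b * d b' * S (k' b + k' b') (Fin.append (fun j => axisReflection 0 (B b j)) (B b')))))
    (hSB : ∀ u v : ℝ, 0 < u → 0 < v → ∀ y : E³, y 0 = 0 →
      ∀ (m : ℕ) (k : Fin m → ℕ) (A : (a : Fin m) → Fin (k a) → E³) (c : Fin m → ℝ)
        (m' : ℕ) (k' : Fin m' → ℕ) (B : (b : Fin m') → Fin (k' b) → E³) (d : Fin m' → ℝ),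
        (∀ a i, 0 < A a i 0) → (∀ b j, 0 < B b j 0) →
        (∑ a, ∑ b, c a * d b * S (k a + 1 + k' b)
            (Fin.append (Fin.append (fun i => axisReflection 0 (A a i + u • e₀)) ![y])
              (fun j => B b j + v • e₀))) ^ 2
          ≤ (C * (u ^ (-Δ) + v ^ (-Δ))) ^ 2 *
            (∑ a, ∑ a', c a * c a' * S (k a + k a') (Fin.append (fun i => axisReflection 0 (A a i)) (A a'))) *
            (∑ b, ∑ b', d b * d b' * S (k' b + k' b') (Fin.append (fun j => axisReflection 0 (B b j)) (B b'))))
    (hPD : ∀ (n : ℕ) (x : Fin n → E³) (r : ℝ), 0 < r → (∀ i j, i ≠ j → r ≤ ‖x i - x j‖) →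
      |S n x| ≤ Cpd ^ (n + 1) * (n.factorial : ℝ) * r ^ (-(n : ℝ) * Δ))
    {n : ℕ} (hn : 3 ≤ n) (x : Fin n → E³)
    (hrot : ∀ m : ℕ, m < n → ∀ (φ : ℝ) (z : Fin m → E³),
      S m (fun i => planeRot (d := 2) 0 φ (z i)) = S m z)
    {θ₀ ε h : ℝ} (hε1 : ε ≤ 1) (hh : 0 < h)
    (hgap : ∀ i j : Fin n, i < j → ∀ θ : ℝ, |θ - θ₀| < ε →
      h ≤ planeRot (d := 2) 0 θ (x j) 0 - planeRot (d := 2) 0 θ (x i) 0) :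
    ∃ F : ℂ → ℂ, DifferentiableOn ℂ F {z : ℂ | |z.re - θ₀| < ε} ∧
      (∀ θ : ℝ, |θ - θ₀| < ε → F θ = ((S n (fun i => planeRot (d := 2) 0 θ (x i)) : ℝ) : ℂ)) ∧
      ∃ K : ℝ, ∀ z : ℂ, |z.re - θ₀| < ε → ‖F z‖ ≤ K * Real.exp (2 * Δ * |z.im|) := by
  -- indices and point families
  obtain ⟨a, ha⟩ : ∃ a : ℕ, a = (n - 2) / 2 := ⟨_, rfl⟩
  obtain ⟨k, hk⟩ : ∃ k : ℕ, a + 3 + k = n := ⟨n - a - 3, by omega⟩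
  have haa : a + a < n := by omega
  have hkk : (k + 1) + (k + 1) < n := by omega
  obtain ⟨g, hg⟩ : ∃ g : Fin (k + 3) → E³, g = fun j : Fin (k + 3) => x ⟨a + j, by omega⟩ := ⟨_, rfl⟩
  obtain ⟨gA, hgA⟩ : ∃ gA : Fin a → E³, gA = fun j : Fin a => x ⟨a - 1 - j, by omega⟩ := ⟨_, rfl⟩
  obtain ⟨w₀, hw₀⟩ : ∃ w₀ : E³, w₀ = planeRot (d := 2) 0 (-θ₀) e₀ := ⟨_, rfl⟩
  obtain ⟨qm, hqm⟩ : ∃ qm : E³, qm = g ⟨0, by omega⟩ - g ⟨0, by omega⟩ 2 • e₂ - (h / 4) • w₀ := ⟨_, rfl⟩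
  obtain ⟨qB, hqB⟩ : ∃ qB : E³, qB = g ⟨2, by omega⟩ - g ⟨2, by omega⟩ 2 • e₂ - (h / 4) • w₀ := ⟨_, rfl⟩
  have hqm2 : qm 2 = 0 := by rw [hqm, hw₀]; exact refPoint_two _ _ _
  have hqB2 : qB 2 = 0 := by rw [hqB, hw₀]; exact refPoint_two _ _ _
  -- heights
  have hTg : ∀ θ : ℝ, ∀ j : Fin (k + 3), planeRot (d := 2) 0 θ (g j) 0 = planeRot (d := 2) 0 θ (x ⟨a + j, by omega⟩) 0 := by
    intro θ j; rw [hg]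
  have hTA : ∀ θ : ℝ, ∀ j : Fin a, planeRot (d := 2) 0 θ (gA j) 0 = planeRot (d := 2) 0 θ (x ⟨a - 1 - j, by omega⟩) 0 := by
    intro θ j; rw [hgA]
  have hcos : ∀ θ : ℝ, |θ - θ₀| < ε → 1 / 2 ≤ Real.cos (θ - θ₀) := fun θ hθ =>
    half_le_cos_of_abs_sub_lt hε1 hθ
  have hcos1 : ∀ θ : ℝ, Real.cos (θ - θ₀) ≤ 1 := fun θ => Real.cos_le_one _
  have hTqm : ∀ θ : ℝ, planeRot (d := 2) 0 θ qm 0 = planeRot (d := 2) 0 θ (g ⟨0, by omega⟩) 0 - h / 4 * Real.cos (θ - θ₀) := by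
    intro θ; rw [hqm, hw₀]; exact planeRot_refPoint_zero _ _ _ _
  have hTqB : ∀ θ : ℝ, planeRot (d := 2) 0 θ qB 0 = planeRot (d := 2) 0 θ (g ⟨2, by omega⟩) 0 - h / 4 * Real.cos (θ - θ₀) := by
    intro θ; rw [hqB, hw₀]; exact planeRot_refPoint_zero _ _ _ _
  have hgg' : ∀ θ : ℝ, |θ - θ₀| < ε → ∀ i j : Fin (k + 3), i < j →
      h ≤ planeRot (d := 2) 0 θ (g j) 0 - planeRot (d := 2) 0 θ (g i) 0 := by
    intro θ hθ i j hij
    have hij' : (i : ℕ) < j := hij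
    rw [hTg, hTg]
    exact hgap _ _ (Fin.mk_lt_mk.2 (by omega)) θ hθ
  -- gap facts
  have hgq : ∀ θ : ℝ, |θ - θ₀| < ε → ∀ j, h / 8 ≤ planeRot (d := 2) 0 θ (g j) 0 - planeRot (d := 2) 0 θ qm 0 := by
    intro θ hθ j
    have hle : planeRot (d := 2) 0 θ (g ⟨0, by omega⟩) 0 ≤ planeRot (d := 2) 0 θ (g j) 0 := by
      rcases Nat.eq_zero_or_pos (j : ℕ) with hj | hj
      · have : j = ⟨0, by omega⟩ := Fin.ext hj
        rw [this]
      · have := hgg' θ hθ ⟨0, by omega⟩ j (Fin.mk_lt_mk.2 hj |>.trans_le le_rfl)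
        linarith
    rw [hTqm]; have := hcos θ hθ; nlinarith
  have hgg : ∀ θ : ℝ, |θ - θ₀| < ε → ∀ i j : Fin (k + 3), i < j →
      h / 8 ≤ planeRot (d := 2) 0 θ (g j) 0 - planeRot (d := 2) 0 θ (g i) 0 := by
    intro θ hθ i j hij; have := hgg' θ hθ i j hij; linarith
  have hgb : ∀ θ : ℝ, |θ - θ₀| < ε →
      h / 8 ≤ planeRot (d := 2) 0 θ qB 0 - planeRot (d := 2) 0 θ (g ⟨1, by omega⟩) 0 := by
    intro θ hθ
    have h12 := hgg' θ hθ ⟨1, by omega⟩ ⟨2, by omega⟩ (Fin.mk_lt_mk.2 (by norm_num))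
    rw [hTqB]; have := hcos1 θ; nlinarith
  have hg0B : ∀ θ : ℝ, |θ - θ₀| < ε → ∀ j : Fin (k + 1),
      h / 8 ≤ planeRot (d := 2) 0 θ (g j.succ.succ) 0 - planeRot (d := 2) 0 θ qB 0 := by
    intro θ hθ j
    have hle : planeRot (d := 2) 0 θ (g ⟨2, by omega⟩) 0 ≤ planeRot (d := 2) 0 θ (g j.succ.succ) 0 := by
      rcases Nat.eq_zero_or_pos (j : ℕ) with hj | hj
      · have : j.succ.succ = ⟨2, by omega⟩ := Fin.ext (by simp [hj])
        rw [this]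
      · have := hgg' θ hθ ⟨2, by omega⟩ j.succ.succ (by simp only [Fin.lt_def, Fin.val_succ]; omega)
        linarith
    rw [hTqB]; have := hcos θ hθ; nlinarith
  have hg0A : ∀ θ : ℝ, |θ - θ₀| < ε → ∀ j, h / 8 ≤ planeRot (d := 2) 0 θ qm 0 - planeRot (d := 2) 0 θ (gA j) 0 := by
    intro θ hθ j
    have := hgap ⟨a - 1 - j, by omega⟩ ⟨a, by omega⟩ (Fin.mk_lt_mk.2 (by omega)) θ hθ
    have e0 : planeRot (d := 2) 0 θ (g ⟨0, by omega⟩) 0 = planeRot (d := 2) 0 θ (x ⟨a, by omega⟩) 0 := hTg θ ⟨0, by omega⟩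
    rw [hTqm, e0, hTA]; have := hcos1 θ; nlinarith
  have hgsA : ∀ θ : ℝ, |θ - θ₀| < ε → ∀ i j : Fin a, i < j →
      h / 8 ≤ planeRot (d := 2) 0 θ (gA i) 0 - planeRot (d := 2) 0 θ (gA j) 0 := by
    intro θ hθ i j hij
    have hij' : (i : ℕ) < j := hij
    have := hgap ⟨a - 1 - j, by omega⟩ ⟨a - 1 - i, by omega⟩ (Fin.mk_lt_mk.2 (by omega)) θ hθ
    rw [hTA, hTA]; linarith
  have hh8 : 0 < h / 8 := by positivity
  have hrect := fun R (hR : 0 < R) => exists_rect_boost_continuation S hΔ δ hδ hK hT hP hLC hSB hPD x hk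
    (hrot _ haa) (hrot _ hkk) g gA (fun j => by rw [hg]) (fun j => by rw [hgA]) qm qB hqm2 hqB2 hh8
    hgq hgg hgb hg0B hg0A hgsA hR
  obtain ⟨F, hFd, hFκ, hFb⟩ := exists_strip_continuation_of_rectangles hrect
  exact ⟨F, hFd, hFκ, _, fun z hz => hFb z hz⟩

end Literature.MathematicalPhysics.QuantumFieldTheory
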